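import Summits.CriticalPhenomena.PercolationContinuityZ3.Theorems.PercNearOneGluingNoHeavyRsw3InvasionTreesDichotomy
import Summits.CriticalPhenomena.PercolationContinuityZ3.Theorems.PercNearOneGluingNoHeavyRsw3InvasionBackboneLabels
import Summits.CriticalPhenomena.PercolationContinuityZ3.Theorems.PercNearOneGluingNoHeavyRsw3InvasionOutletDictionary
import HarnessLib

/-!
# RSW3 lane (P2, gen 29): INVASION PERCOLATION XLII — `ℤ³` SUMMARY: the critical invasion structure of `ℤ³` after p205010, in one statement

builds on p205010 (kernel theorem, internal audit signed; external expert review pending) — USED (every conjunct below is unconditional only because `θ(p_c(ℤ³)) = 0`).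
Status sentence: "θ(p_c) = 0 on ℤ^d, all d ≥ 2 — kernel-verified (Lean 4/Mathlib, standard axioms); internal adversarial audit SIGNED 2026-08-20 04:29Z; external expert review pending."

Cell `prim-rsw3`, prover seat `prim-rsw3-p2` (gen 29), memo `run/shared/lean/prim/rsw3/P2-RSWLITE.md` §36.  Support file
(`--supports stmt-CriticalPhenomena-4575`); no definitions, no named facts, no sorries.  A packaging of files XXVIII–XLI for `d = 3`.

* **`invasion_Z3_structure`** — almost surely, for invasion percolation on `ℤ³` with i.i.d. uniform labels:
  (1) for EVERY root `x`, the invasion tree `T(x)` has outlets beyond every time and EXACTLY ONE self-avoiding ray from `x` (one end; Lyons–Peres–Schramm 2006 Thm 3.12 ¶1 /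
      Alexander 1995, there conditional on `θ(p_c) = 0`);
  (2) from the origin: the outlet labels are `> p_c(ℤ³)`, strictly decreasing, eventually below every `y > p_c` (Damron–Sapozhnikov–Vágvölgyi's `τ̂_k ↓ p_c`);
  (3) along the backbone from the origin the labels exceed `p_c` infinitely often and are eventually `≤ y` for every `y > p_c` (`limsup = p_c`);
  (4) any two invasion trees have disjoint invaded regions or differ in finitely many bonds with tail-equivalent backbones (LPS06 Prop 3.4; canonical end);
  (5) the WMSF of `ℤ³` is the union of the invasion trees (LPS06 Prop 3.3).
* `percolationContinuity_three_iff_ae_exists_isOutlet` — and the dictionary: `θ(p_c(ℤ³)) = 0 ⟺` a.s. the invasion from the origin has an outlet (both sides hold).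

References: R. Lyons, Y. Peres, O. Schramm, Ann. Probab. 34 (2006) [LyonsPeresSchramm2006]; M. Damron, A. Sapozhnikov, B. Vágvölgyi, Ann. Probab. 37 (2009); J. T. Chayes,
L. Chayes, C. M. Newman, Comm. Math. Phys. 101 (1985) [ChayesChayesNewman1985].
-/

noncomputable section

namespace Summit.CriticalPhenomena.PercolationContinuityZ3.Theorems.Rsw3

open Finset Filter MeasureTheory Literature.Probability.LatticeModels Literature.Probability.Percolation Literature.Probability.Percolation.Invasion

/-- **THE CRITICAL INVASION STRUCTURE OF `ℤ³` (after p205010), almost surely**: (1) every invasion tree `T(x)` has outlets beyond every time and exactly one ray from `x`;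
(2) the origin's outlet labels are `> p_c`, strictly decreasing, eventually `≤ y` for every `y > p_c`; (3) along every ray of `T(0)` from `0` the labels are `> p_c`
infinitely often and eventually `≤ y` for every `y > p_c`; (4) for all `x, y`: disjoint invaded regions, or `T(x) △ T(y)` finite with tail-equivalent backbones; (5) the
WMSF is the union of the invasion trees. [cite: LyonsPeresSchramm2006, Thm. 1.1, Prop. 3.3, Prop. 3.4, Thm. 3.12 (proof)] -/
theorem invasion_Z3_structure :
    ∀ᵐ U ∂(labelMeasure (Site 3)),
      (∀ x : Site 3, (∀ k, ∃ m, k ≤ m ∧ IsOutlet (zdGraph 3) U x m) ∧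
        ∃! r : ℕ → Site 3, Function.Injective r ∧ r 0 = x ∧ ∀ i, (tree (zdGraph 3) U x).Adj (r i) (r (i + 1))) ∧
      ((∀ m, IsOutlet (zdGraph 3) U 0 m → criticalProb (zdGraph 3) (0 : Site 3) < acceptedLabel (zdGraph 3) U 0 m) ∧
        (∀ m m', IsOutlet (zdGraph 3) U 0 m → m < m' → acceptedLabel (zdGraph 3) U 0 m' < acceptedLabel (zdGraph 3) U 0 m) ∧
        (∀ y : ℝ, criticalProb (zdGraph 3) (0 : Site 3) < y → ∀ᶠ m in atTop, IsOutlet (zdGraph 3) U 0 m → acceptedLabel (zdGraph 3) U 0 m ≤ y)) ∧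
      (∀ R : ℕ → Site 3, Function.Injective R → R 0 = 0 → (∀ i, (tree (zdGraph 3) U 0).Adj (R i) (R (i + 1))) →
        (∃ᶠ i in atTop, criticalProb (zdGraph 3) (0 : Site 3) < U s(R i, R (i + 1))) ∧
        ∀ y : ℝ, criticalProb (zdGraph 3) (0 : Site 3) < y → ∀ᶠ i in atTop, U s(R i, R (i + 1)) ≤ y) ∧
      (∀ x y : Site 3, Disjoint (invadedRegion (zdGraph 3) U x) (invadedRegion (zdGraph 3) U y) ∨
        ((symmDiff (treeEdges (zdGraph 3) U x) (treeEdges (zdGraph 3) U y)).Finite ∧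
          ∀ rx ry : ℕ → Site 3, Function.Injective rx → rx 0 = x → (∀ i, (tree (zdGraph 3) U x).Adj (rx i) (rx (i + 1))) →
            Function.Injective ry → ry 0 = y → (∀ i, (tree (zdGraph 3) U y).Adj (ry i) (ry (i + 1))) →
            ∃ a b, ∀ k, rx (a + k) = ry (b + k))) ∧
      (⋃ x, treeEdges (zdGraph 3) U x) = wmsf (zdGraph 3) U := by
  have hd : 2 ≤ 3 := by norm_num
  filter_upwards [ae_forall_root_existsUnique_ray hd, ae_outlets hd, ae_backbone_labels hd, ae_invasionTrees_dichotomy hd,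
    ae_iUnion_treeEdges_eq_wmsf (d := 3) (by norm_num)] with U h1 h2 h3 h4 h5
  exact ⟨h1, ⟨h2.2.1, h2.2.2.1, fun y hy => (h2.2.2.2 y hy).mono fun m hm hout => (hm hout).2⟩, h3, h4, h5⟩

/-- **The outlet dictionary for `ℤ³`**: `θ(p_c(ℤ³)) = 0` iff a.s. the invasion from the origin has an outlet — and both hold (p205010).
[cite: LyonsPeresSchramm2006, Thm. 3.12 (proof)] -/
theorem percolationContinuity_three_iff_ae_exists_isOutlet :
    (PercolationContinuity 3 ↔ ∀ᵐ U ∂(labelMeasure (Site 3)), ∃ m, IsOutlet (zdGraph 3) U 0 m) ∧ PercolationContinuity 3 :=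
  ⟨percolationContinuity_iff_ae_exists_isOutlet (by norm_num), CSH.percolationContinuity_allDimensions 3 (by norm_num)⟩

end Summit.CriticalPhenomena.PercolationContinuityZ3.Theorems.Rsw3
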